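import Summits.QuantumFields.BalabanUV.T4Continuum.Spine.NE7cSmoothingLocal

/-!
# T⁴ programme, spine node NE7c (U5b) — ROAD P3 «SMOOTHING»: the every-`K` END-TO-END FACE of the (η)-layer with the LOCALISED
# old-density sandwich — the drop-in twin of `T4PatternLayer.cauchy_of_finest_patterned` under the binder shape `hswL`

Cell `pub-balaban`, BINDER-OWNERS row NE7c, co-owner #3 = unit `b2b-balaban-t4-ne7c-p3` (GEN 2), skeleton
`HOME/t4/skeletons/NE7c-t4-ne7c-p3.md` §4 («WHERE R IS LOAD-BEARING»); companion of `Spine/NE7cSmoothingLocal` (p208168: the letterless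
certificate for the GLOBAL binder and the localised core sandwich) and `Spine/NE7cSmoothingLocalSocket` (END-S-local, tail form).

WHAT THIS MODULE ADDS ([folklore], 0 sorry, compositions by name).  `cauchy_of_finest_patterned_local`: pv07's end-to-end face
`T4PatternLayer.cauchy_of_finest_patterned` (all-patterned (η)-layer; binders: profiles, data, (F∞) `hvc`, older weights, row NE7b's
`RelWeightBound` at the OLDER level on `fixW`, the every-`K` budget `hlt`, the partition-function identities and positivity on `fixW`,
summable `δ`) with its LAST binder — node U5b's old-density sandwich `hsw`, there GLOBAL (a.e. on the whole window space per good older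
history) — REPLACED by the LOCALISED `hswL`: the sandwich is required only per good LAYERED term `τ = (τ', S)` and only at window
configurations in the term's joint polarity event (every declared letter of pattern `S` «on» in both runs; for the all-small pattern the
COMMON SMALL-FIELD REGION).  Same four conclusions (matching modulo constants with `hybridDelta vol δ (W + band)`, its summability, the
Cauchy property of every generating function on `|t| ≤ l₀`, uniform convergence).  Assembly: NE7b transported by neutrality
(`relWeightBound_layer₂`, `sum_layerOver_layerX₂`), NE7c = END-W (`NE7cSmoothing.shellWeightBound_patterned`, p206673), the core datum =
`NE7cSmoothingLocal.coreSandwich_layer_local` (p208168), closed by `T4IndicatorShell.cauchy_of_relWeightBound_shell`.  Under `hswL` the declared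
letters are NOT inert (contrast `NE7cSmoothingLocal.cauchy_letterless`): the window shell weight is the price of the localisation.
`cauchy_of_finest_patterned_local_of_localRate`: the same with (F∞) discharged from node U1b's `LocalRate` (END-R's binders).

HONEST FRAMING.  Bookkeeping over binders; nothing of Bałaban's asserted; `hswL` is node U5b's (supplier pv07's successor), NE3's rate, NE7b's
bound, the (o1) instantiation (NODE O) and the ruling Lq-P3-2 (binder shape of `hsw`) are other seats'.  FIXED finite T⁴, rung (B)+1; NOT
infinite volume, NOT a mass gap, NOT Clay, NOT summit progress; spine 0/9.  HONEST DEPENDENCY: continuum YM on T⁴ ⇐ BetaPertH ∧ nine spine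
estimates (0/9 proved); BetaPertH ⇐ (D1) ∧ (D4) ∧ CAP+tail; G-an2-4 gates asym, D1 and NE2/3/4.
-/

noncomputable section

open MeasureTheory Finset Filter
open scoped NNReal ENNReal

namespace Summit.QuantumFields.BalabanUV.T4Continuum.NE7cSmoothingLocalCauchy

open Literature.MathematicalPhysics.QuantumFieldTheory.Balaban1983to89
open T4Continuum T4LevelShift T4AveragingDisintegration T4WindowLevelShift T4LipschitzLedger T4FiniteEpsInhabited
  BlockAveraging ExpMeanLog T4FinestToWindow T4AgeZeroLayer T4PatternLayer T4SupCloseLiaison T4EtaRateMin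
open T4IndicatorShell T4LipschitzCutoff T4WeightBudget T4HybridMatching T4MatchingAssembly T4CauchySum
open Summit.QuantumFields.BalabanUV.T4Continuum.NE7cSmoothing Summit.QuantumFields.BalabanUV.T4Continuum.NE7cSmoothingLocal

variable {ι₀ Dat Sit : Type*} [DecidableEq ι₀] {N : ℕ} [NeZero N] (F : T4Family)

/-- **pv07's END-TO-END FACE OF THE (η)-LAYER WITH THE LOCALISED OLD-DENSITY SANDWICH** (drop-in twin of
`T4PatternLayer.cauchy_of_finest_patterned`: identical binders except `hsw` ↦ `hswL`; identical conclusions). [folklore] -/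
theorem cauchy_of_finest_patterned_local {l₀ vol : ℝ} {T₀ : ℕ → Finset ι₀} {Bad₀ : ℕ → ℝ → Finset ι₀} {W δ ρ : ℕ → ℝ}
    {χ : ℕ → ℝ → ℝ} {κ Lχ : ℕ → ℝ} (hχ : ∀ a, LipProfile (χ a) (κ a) (Lχ a)) {N₀ : ℕ} {n : ℕ → ℕ}
    {NW₀ : ι₀ → ℕ} (hNW : ∀ K, ∀ τ' ∈ T₀ K, NW₀ τ' ≤ K) {m₀ : ℕ → ι₀ → ℕ} {slot₀ : ℕ → ι₀ → ℕ → Σ _ : ℕ, ℕ}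
    (hwin : ∀ K, ∀ τ' ∈ T₀ K, ∀ i < m₀ K τ', slot₀ K τ' i ∈ (range (N₀ + 1)).sigma fun a => range (n a))
    (hband : ∀ K, ∀ τ' ∈ T₀ K, ∀ i < m₀ K τ', (slot₀ K τ' i).1 ≤ K)
    (hinj : ∀ K, ∀ τ' ∈ T₀ K, ∀ j < m₀ K τ', ∀ j' < m₀ K τ', slot₀ K τ' j = slot₀ K τ' j' → j = j')
    {fpol : ℕ → ι₀ → ℕ → Pol} {θ₀ : ℕ → ι₀ → ℕ → ℝ} (hθ : ∀ K, ∀ τ' ∈ T₀ K, ∀ i < m₀ K τ', 0 < θ₀ K τ' i)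
    {vA vB : (K : ℕ) → (τ' : ι₀) → ℕ → GaugeField (F.P (NW₀ τ')) 0 (SU N) → ℝ}
    (hvm : ∀ K, ∀ τ' ∈ T₀ K, ∀ i < m₀ K τ', Measurable (vA K τ' i) ∧ Measurable (vB K τ' i))
    (hvc : ∀ K, ∀ τ' ∈ T₀ K, ∀ i < m₀ K τ', ∀ᵐ V ∂fieldMeasure (F.P (NW₀ τ')) 0 (SU N),
      |vA K τ' i V - vB K τ' i V| ≤ ρ (K - (slot₀ K τ' i).1) * θ₀ K τ' i)
    {RA : (K : ℕ) → ℝ → ι₀ → GaugeField (F.P K) 0 (SU N) → ℝ}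
    {RB : (K : ℕ) → ℝ → ι₀ → GaugeField (F.P (K + 1)) 0 (SU N) → ℝ}
    (hRA0 : ∀ K t, |t| ≤ l₀ → ∀ τ' ∈ T₀ K, 0 ≤ᵐ[fieldMeasure (F.P K) 0 (SU N)] RA K t τ')
    (hRAi : ∀ K t, |t| ≤ l₀ → ∀ τ' ∈ T₀ K, Integrable (RA K t τ') (fieldMeasure (F.P K) 0 (SU N)))
    (hRB0 : ∀ K t, |t| ≤ l₀ → ∀ τ' ∈ T₀ K, 0 ≤ᵐ[fieldMeasure (F.P (K + 1)) 0 (SU N)] RB K t τ')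
    (hRBi : ∀ K t, |t| ≤ l₀ → ∀ τ' ∈ T₀ K, Integrable (RB K t τ') (fieldMeasure (F.P (K + 1)) 0 (SU N)))
    (hW : RelWeightBound l₀ T₀ (fixW F χ NW₀ m₀ m₀ slot₀ fpol θ₀ vA (fun K => K) RA)
      (fixW F χ NW₀ m₀ m₀ slot₀ fpol θ₀ vB (fun K => K + 1) RB) Bad₀ W)
    (hvol : 0 < vol) (hl₀ : 0 ≤ l₀) (hρ0 : ∀ j, 0 ≤ ρ j) (hρ : Summable ρ)
    (hlt : ∀ K, W K + ∑ a ∈ range (N₀ + 1), (n a : ℝ) * lipWeight Lχ (fun _ => 2) ρ a K < 1) {Z : ℕ → ℝ → ℝ}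
    (hZA : ∀ K t, |t| ≤ l₀ → Z K t = ∑ τ' ∈ T₀ K, fixW F χ NW₀ m₀ m₀ slot₀ fpol θ₀ vA (fun K => K) RA K t τ')
    (hZB : ∀ K t, |t| ≤ l₀ → Z (K + 1) t = ∑ τ' ∈ T₀ K, fixW F χ NW₀ m₀ m₀ slot₀ fpol θ₀ vB (fun K => K + 1) RB K t τ')
    (hpos : ∀ K t, |t| ≤ l₀ → 0 < ∑ τ' ∈ T₀ K, fixW F χ NW₀ m₀ m₀ slot₀ fpol θ₀ vA (fun K => K) RA K t τ')
    (hδ : Summable δ) {c : ℕ → ℝ}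
    (hswL : ∀ K t, |t| ≤ l₀ → ∀ τ ∈ layerT₂ T₀ m₀ K \ layerOver (Bad₀ K t) (m₀ K),
      (∀ᵐ V ∂fieldMeasure (F.P (NW₀ τ.1)) 0 (SU N),
        (∀ i < m₀ K τ.1, facAt χ (slot₀ K τ.1) (layerPol₂ m₀ fpol K τ) (θ₀ K τ.1) (fun j => vA K τ.1 j V) i ≠ 0 ∧
            facAt χ (slot₀ K τ.1) (layerPol₂ m₀ fpol K τ) (θ₀ K τ.1) (fun j => vB K τ.1 j V) i ≠ 0) →
          Real.exp (c K - vol * δ K) * (oldDensity F (expMeanLogSU : LoopAverage (SU N)) K (NW₀ τ.1) (RA K t τ.1) V : ℝ) ≤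
            (oldDensity F (expMeanLogSU : LoopAverage (SU N)) (K + 1) (NW₀ τ.1) (RB K t τ.1) V : ℝ)) ∧
      (∀ᵐ V ∂fieldMeasure (F.P (NW₀ τ.1)) 0 (SU N),
        (∀ i < m₀ K τ.1, facAt χ (slot₀ K τ.1) (layerPol₂ m₀ fpol K τ) (θ₀ K τ.1) (fun j => vA K τ.1 j V) i ≠ 0 ∧
            facAt χ (slot₀ K τ.1) (layerPol₂ m₀ fpol K τ) (θ₀ K τ.1) (fun j => vB K τ.1 j V) i ≠ 0) →
          (oldDensity F (expMeanLogSU : LoopAverage (SU N)) (K + 1) (NW₀ τ.1) (RB K t τ.1) V : ℝ) ≤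
            Real.exp (c K + vol * δ K) *
              (oldDensity F (expMeanLogSU : LoopAverage (SU N)) K (NW₀ τ.1) (RA K t τ.1) V : ℝ))) :
    MatchingModConstants vol l₀
        (hybridDelta vol δ fun K => W K + ∑ a ∈ range (N₀ + 1), (n a : ℝ) * lipWeight Lχ (fun _ => 2) ρ a K) Z ∧
      Summable (hybridDelta vol δ fun K => W K + ∑ a ∈ range (N₀ + 1), (n a : ℝ) * lipWeight Lχ (fun _ => 2) ρ a K) ∧
      (∀ t : ℝ, |t| ≤ l₀ → CauchySeq fun K => genFun Z K t) ∧
      TendstoUniformlyOn (fun K t => genFun Z K t) (genFunLim Z) Filter.atTop {t | |t| ≤ l₀} := by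
  -- NE7b transported to the layer by neutrality
  have hsumA : ∀ K t, |t| ≤ l₀ → ∀ B' ⊆ T₀ K, ∑ τ ∈ layerOver B' (m₀ K),
      layerX₂ F χ NW₀ m₀ m₀ slot₀ fpol θ₀ vA (fun K => K) RA K t τ =
        ∑ τ' ∈ B', fixW F χ NW₀ m₀ m₀ slot₀ fpol θ₀ vA (fun K => K) RA K t τ' :=
    fun K t ht B' hB' => sum_layerOver_layerX₂ F (fun K => K) hχ (fun _ _ _ => le_rfl) hvm hRAi K ht hB'
  have hsumB : ∀ K t, |t| ≤ l₀ → ∀ B' ⊆ T₀ K, ∑ τ ∈ layerOver B' (m₀ K),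
      layerX₂ F χ NW₀ m₀ m₀ slot₀ fpol θ₀ vB (fun K => K + 1) RB K t τ =
        ∑ τ' ∈ B', fixW F χ NW₀ m₀ m₀ slot₀ fpol θ₀ vB (fun K => K + 1) RB K t τ' :=
    fun K t ht B' hB' => sum_layerOver_layerX₂ F (fun K => K + 1) hχ (fun _ _ _ => le_rfl)
      (fun K τ hτ i hi => (hvm K τ hτ i hi).symm) hRBi K ht hB'
  have hW' := relWeightBound_layer₂ (md := m₀) hW hsumA hsumB
  -- the partition functions and positivity on the layer
  have hZA' : ∀ K t, |t| ≤ l₀ →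
      Z K t = ∑ τ ∈ layerT₂ T₀ m₀ K, layerX₂ F χ NW₀ m₀ m₀ slot₀ fpol θ₀ vA (fun K => K) RA K t τ :=
    fun K t ht => by rw [layerT₂, hsumA K t ht _ subset_rfl]; exact hZA K t ht
  have hZB' : ∀ K t, |t| ≤ l₀ →
      Z (K + 1) t = ∑ τ ∈ layerT₂ T₀ m₀ K, layerX₂ F χ NW₀ m₀ m₀ slot₀ fpol θ₀ vB (fun K => K + 1) RB K t τ :=
    fun K t ht => by rw [layerT₂, hsumB K t ht _ subset_rfl]; exact hZB K t ht
  have hpos' : ∀ K t, |t| ≤ l₀ →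
      0 < ∑ τ ∈ layerT₂ T₀ m₀ K, layerX₂ F χ NW₀ m₀ m₀ slot₀ fpol θ₀ vA (fun K => K) RA K t τ :=
    fun K t ht => by rw [layerT₂, hsumA K t ht _ subset_rfl]; exact hpos K t ht
  -- NE7c: END-W; the core datum: the LOCALISED sandwich
  have hSh := shellWeightBound_patterned F (fpol := fpol) hχ hNW hwin hband hinj hθ hvm hvc hRA0 hRAi hRB0 hRBi hρ0 hρ
  have hcore := coreSandwich_layer_local F (fpol := fpol) (Bad := fun K t => layerOver (Bad₀ K t) (m₀ K)) (δ := δ) (c := c)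
    hχ hNW hwin hband hθ hvm hRA0 hRAi hRB0 hRBi hswL
  exact cauchy_of_relWeightBound_shell hvol hl₀ hW' hSh hlt hZA' hZB' hpos' hδ hcore

/-- **… WITH (F∞) DISCHARGED FROM NODE U1b's `LocalRate`** (END-R's binders: `ReadsLevels`, a positive threshold floor; width
`geomWidth C θmin ϑ`). [folklore] -/
theorem cauchy_of_finest_patterned_local_of_localRate {l₀ vol : ℝ} {T₀ : ℕ → Finset ι₀} {Bad₀ : ℕ → ℝ → Finset ι₀}
    {W δ : ℕ → ℝ} {R : Readings Dat Sit} {C ϑ θmin : ℝ}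
    {χ : ℕ → ℝ → ℝ} {κ Lχ : ℕ → ℝ} (hχ : ∀ a, LipProfile (χ a) (κ a) (Lχ a)) {N₀ : ℕ} {n : ℕ → ℕ}
    {NW₀ : ι₀ → ℕ} (hNW : ∀ K, ∀ τ' ∈ T₀ K, NW₀ τ' ≤ K) {m₀ : ℕ → ι₀ → ℕ} {slot₀ : ℕ → ι₀ → ℕ → Σ _ : ℕ, ℕ}
    (hwin : ∀ K, ∀ τ' ∈ T₀ K, ∀ i < m₀ K τ', slot₀ K τ' i ∈ (range (N₀ + 1)).sigma fun a => range (n a))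
    (hband : ∀ K, ∀ τ' ∈ T₀ K, ∀ i < m₀ K τ', (slot₀ K τ' i).1 ≤ K)
    (hinj : ∀ K, ∀ τ' ∈ T₀ K, ∀ j < m₀ K τ', ∀ j' < m₀ K τ', slot₀ K τ' j = slot₀ K τ' j' → j = j')
    {fpol : ℕ → ι₀ → ℕ → Pol} {θ₀ : ℕ → ι₀ → ℕ → ℝ} (hmin : 0 < θmin) (hθf : ThresholdFloor T₀ m₀ θ₀ θmin)
    {vA vB : (K : ℕ) → (τ' : ι₀) → ℕ → GaugeField (F.P (NW₀ τ')) 0 (SU N) → ℝ}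
    (hvm : ∀ K, ∀ τ' ∈ T₀ K, ∀ i < m₀ K τ', Measurable (vA K τ' i) ∧ Measurable (vB K τ' i))
    (hloc : LocalRate R C ϑ) (hC : 0 ≤ C) (hϑ0 : 0 ≤ ϑ) (hϑ1 : ϑ < 1)
    (hR : ReadsLevels R T₀ (fun _ τ' => fieldMeasure (F.P (NW₀ τ')) 0 (SU N)) m₀ slot₀ vA vB)
    {RA : (K : ℕ) → ℝ → ι₀ → GaugeField (F.P K) 0 (SU N) → ℝ}
    {RB : (K : ℕ) → ℝ → ι₀ → GaugeField (F.P (K + 1)) 0 (SU N) → ℝ}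
    (hRA0 : ∀ K t, |t| ≤ l₀ → ∀ τ' ∈ T₀ K, 0 ≤ᵐ[fieldMeasure (F.P K) 0 (SU N)] RA K t τ')
    (hRAi : ∀ K t, |t| ≤ l₀ → ∀ τ' ∈ T₀ K, Integrable (RA K t τ') (fieldMeasure (F.P K) 0 (SU N)))
    (hRB0 : ∀ K t, |t| ≤ l₀ → ∀ τ' ∈ T₀ K, 0 ≤ᵐ[fieldMeasure (F.P (K + 1)) 0 (SU N)] RB K t τ')
    (hRBi : ∀ K t, |t| ≤ l₀ → ∀ τ' ∈ T₀ K, Integrable (RB K t τ') (fieldMeasure (F.P (K + 1)) 0 (SU N)))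
    (hW : RelWeightBound l₀ T₀ (fixW F χ NW₀ m₀ m₀ slot₀ fpol θ₀ vA (fun K => K) RA)
      (fixW F χ NW₀ m₀ m₀ slot₀ fpol θ₀ vB (fun K => K + 1) RB) Bad₀ W)
    (hvol : 0 < vol) (hl₀ : 0 ≤ l₀)
    (hlt : ∀ K, W K + ∑ a ∈ range (N₀ + 1), (n a : ℝ) * lipWeight Lχ (fun _ => 2) (geomWidth C θmin ϑ) a K < 1)
    {Z : ℕ → ℝ → ℝ}
    (hZA : ∀ K t, |t| ≤ l₀ → Z K t = ∑ τ' ∈ T₀ K, fixW F χ NW₀ m₀ m₀ slot₀ fpol θ₀ vA (fun K => K) RA K t τ')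
    (hZB : ∀ K t, |t| ≤ l₀ → Z (K + 1) t = ∑ τ' ∈ T₀ K, fixW F χ NW₀ m₀ m₀ slot₀ fpol θ₀ vB (fun K => K + 1) RB K t τ')
    (hpos : ∀ K t, |t| ≤ l₀ → 0 < ∑ τ' ∈ T₀ K, fixW F χ NW₀ m₀ m₀ slot₀ fpol θ₀ vA (fun K => K) RA K t τ')
    (hδ : Summable δ) {c : ℕ → ℝ}
    (hswL : ∀ K t, |t| ≤ l₀ → ∀ τ ∈ layerT₂ T₀ m₀ K \ layerOver (Bad₀ K t) (m₀ K),
      (∀ᵐ V ∂fieldMeasure (F.P (NW₀ τ.1)) 0 (SU N),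
        (∀ i < m₀ K τ.1, facAt χ (slot₀ K τ.1) (layerPol₂ m₀ fpol K τ) (θ₀ K τ.1) (fun j => vA K τ.1 j V) i ≠ 0 ∧
            facAt χ (slot₀ K τ.1) (layerPol₂ m₀ fpol K τ) (θ₀ K τ.1) (fun j => vB K τ.1 j V) i ≠ 0) →
          Real.exp (c K - vol * δ K) * (oldDensity F (expMeanLogSU : LoopAverage (SU N)) K (NW₀ τ.1) (RA K t τ.1) V : ℝ) ≤
            (oldDensity F (expMeanLogSU : LoopAverage (SU N)) (K + 1) (NW₀ τ.1) (RB K t τ.1) V : ℝ)) ∧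
      (∀ᵐ V ∂fieldMeasure (F.P (NW₀ τ.1)) 0 (SU N),
        (∀ i < m₀ K τ.1, facAt χ (slot₀ K τ.1) (layerPol₂ m₀ fpol K τ) (θ₀ K τ.1) (fun j => vA K τ.1 j V) i ≠ 0 ∧
            facAt χ (slot₀ K τ.1) (layerPol₂ m₀ fpol K τ) (θ₀ K τ.1) (fun j => vB K τ.1 j V) i ≠ 0) →
          (oldDensity F (expMeanLogSU : LoopAverage (SU N)) (K + 1) (NW₀ τ.1) (RB K t τ.1) V : ℝ) ≤
            Real.exp (c K + vol * δ K) *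
              (oldDensity F (expMeanLogSU : LoopAverage (SU N)) K (NW₀ τ.1) (RA K t τ.1) V : ℝ))) :
    MatchingModConstants vol l₀
        (hybridDelta vol δ fun K => W K + ∑ a ∈ range (N₀ + 1), (n a : ℝ) * lipWeight Lχ (fun _ => 2) (geomWidth C θmin ϑ) a K)
        Z ∧
      Summable (hybridDelta vol δ fun K =>
        W K + ∑ a ∈ range (N₀ + 1), (n a : ℝ) * lipWeight Lχ (fun _ => 2) (geomWidth C θmin ϑ) a K) ∧
      (∀ t : ℝ, |t| ≤ l₀ → CauchySeq fun K => genFun Z K t) ∧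
      TendstoUniformlyOn (fun K t => genFun Z K t) (genFunLim Z) Filter.atTop {t | |t| ≤ l₀} := by
  have hθ : ∀ K, ∀ τ' ∈ T₀ K, ∀ i < m₀ K τ', 0 < θ₀ K τ' i := hθf.thr_pos hmin
  have hF₀ : SupClose T₀ (fun _ τ' => fieldMeasure (F.P (NW₀ τ')) 0 (SU N)) m₀ slot₀ θ₀ vA vB (geomWidth C θmin ϑ) :=
    supClose_of_localRate hloc hR hmin hθf
  exact cauchy_of_finest_patterned_local F hχ hNW hwin hband hinj hθ hvm (fun K τ' hτ' i hi => hF₀ K τ' hτ' i hi)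
    hRA0 hRAi hRB0 hRBi hW hvol hl₀ (geomWidth_nonneg hC hmin.le hϑ0) (summable_geomWidth hϑ0 hϑ1) hlt hZA hZB hpos hδ hswL

end Summit.QuantumFields.BalabanUV.T4Continuum.NE7cSmoothingLocalCauchy

end
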